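import Summits.CriticalPhenomena.PercolationContinuityZ3.Theorems.PercNearOneGluingNoHeavyLowerTailAntitheticPieces
import HarnessLib

/-!
# `NoHeavyLowerTail` (stmt-CriticalPhenomena-4575) — antithetic cluster pairs: the FROZEN PIECE LEMMA
# (prim-hp-2 gen 46, MEMO-gen46 §1)

Support file (`--supports stmt-CriticalPhenomena-4575`, hull-port prover `prim-hp-2`, gen 46).  No definitions, no
named facts, no sorries; standard axioms.

Setting (MEMO-gen31, MEMO-gen32, MEMO-gen40 §3): colourings `ω ⊆ Sym2 V` of an edge set `E` (`ω` red, `ωᶜ` blue), RED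
cluster `C_s(ω ∩ E)`, BLUE cluster `C_s(ωᶜ ∩ E)`; `Δ(ω) = (F(red) − F(blue))(G(red) − G(blue))` for increasing `F, G`.
Gen 32's PIECE LEMMA (`Antithetic.piece_abstract`, `piece_sum_nonneg`) says: if the blocks `g i` (`i ∈ β`) partition `E` and
the red cluster of `ω⁺ ∆ ⋃_{i ∈ S} g i` is antitone in `S`, the antithetic sum over the whole flip cube `S ⊆ β` is `≥ 0`
(centred Harris: the two factors are antitone with ZERO mean, by the involution `S ↦ Sᶜ`).

THE FROZEN PIECE LEMMA (this file, new in gen 46) removes the zero-mean requirement and thereby allows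
(a) a FROZEN block `Z` (the edges of `E` outside the flipped blocks) kept in its "up" state in every member — provided
    flipping `Z` down would shrink the red cluster — or kept "down" in every member (mirror statement); and
(b) ONE-SIDED AUGMENTATIONS of the clusters by markers: the red-side set may be replaced by any antitone `A S ⊇ red S`
    (e.g. `red S ∪ {e}·[y ∈ W(S)]`, the pendant lift at a vertex `y`, as in the change family of CONJECTURE Δ2,
    MEMO-gen40 §3) when the frozen block is up, and the blue side by any isotone `B S ⊇ blue S` when it is down.
The proof is two lines: the factors `a S = F(A S) − F(blue S)`, `b S` are antitone on the cube, so Harris gives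
`|cube| · Σ a b ≥ (Σ a)(Σ b)`; and `Σ a ≥ 0`, `Σ b ≥ 0` because `blue S = red(Z-flipped member Sᶜ) ⊆ red Sᶜ ⊆ A Sᶜ` termwise
after the reindexing `S ↦ Sᶜ`.  The plain piece lemma is the case `Z = ∅`, `A = red`.  The four-value inequality of
THEOREM C′ (`Quad.four_value`, gen 42) is the case of ONE flipped block with the rest frozen.

* `Antithetic.harris_uniform_cov` — Harris in covariance form for monotone `a, b` of any sign:
  `(Σ a)(Σ b) ≤ |Set ι| · Σ a b`;  `Antithetic.sum_mul_nonneg_of_antitone` — antitone `a, b` with `Σ a ≥ 0`, `Σ b ≥ 0`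
  have `Σ a b ≥ 0`.
* `Antithetic.frozen_piece_abstract` — the order-theoretic core: `Ψ ≤ Φ : Set β → α` both antitone, `F, G` monotone ⇒
  `0 ≤ Σ_S (F(Φ S) − F(Ψ Sᶜ))(G(Φ S) − G(Ψ Sᶜ))`.
* `Antithetic.frozen_piece_sum_nonneg` (frozen block UP, red-side augmentation `A`) and
  `Antithetic.frozen_piece_sum_nonneg_down` (frozen block DOWN, blue-side augmentation `B`) — the cluster forms.
* `Antithetic.compl_symmDiff_inter_frozen`, `Antithetic.frozen_blue_eq_red_compl` — the identity
  `blue(ω ∆ ⋃_{S} g) = red((ω ∆ ⋃_{Sᶜ} g) ∆ Z)` on `E` when the blocks and `Z` partition `E`.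
[cite: VandenbergHaggstromKahn2005, §1 p. 6 ("Harris' inequality")]
-/

noncomputable section

namespace Summit.CriticalPhenomena.PercolationContinuityZ3.Theorems

open Literature.Probability.Percolation
open scoped Classical symmDiff

namespace Antithetic

section Lattice

variable {ι : Type*} [Fintype ι]

/-- **Harris' inequality, covariance form** on the Boolean lattice `Set ι` with counting weight: for monotone `a, b` of any
sign, `(Σ a)(Σ b) ≤ |Set ι| · Σ a b`.  (Centred Harris `harris_uniform_centred` applied to `a − mean a`, `b − mean b`.)
[cite: VandenbergHaggstromKahn2005, §1 p. 6 ("Harris' inequality")] -/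
theorem harris_uniform_cov {a b : Set ι → ℝ} (ha : Monotone a) (hb : Monotone b) :
    (∑ ω, a ω) * ∑ ω, b ω ≤ (Fintype.card (Set ι) : ℝ) * ∑ ω, a ω * b ω := by
  set N : ℝ := (Fintype.card (Set ι) : ℝ) with hN
  have hNpos : (0 : ℝ) < N := by
    rw [hN]; exact_mod_cast Fintype.card_pos
  set A : ℝ := ∑ ω, a ω with hA
  set B : ℝ := ∑ ω, b ω with hB
  have h := harris_uniform_centred (a := fun ω => a ω - A / N) (b := fun ω => b ω - B / N)
    (fun x y hxy => sub_le_sub_right (ha hxy) _) (fun x y hxy => sub_le_sub_right (hb hxy) _)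
    (by rw [Finset.sum_sub_distrib, Finset.sum_const, Finset.card_univ, nsmul_eq_mul, ← hA]; field_simp; ring)
    (by rw [Finset.sum_sub_distrib, Finset.sum_const, Finset.card_univ, nsmul_eq_mul, ← hB]; field_simp; ring)
  have e : ∑ ω, (a ω - A / N) * (b ω - B / N) = ∑ ω, a ω * b ω - A * B / N := by
    have : ∀ ω, (a ω - A / N) * (b ω - B / N) = a ω * b ω - B / N * a ω - A / N * b ω + A / N * (B / N) :=
      fun ω => by ring
    simp_rw [this]
    rw [Finset.sum_add_distrib, Finset.sum_sub_distrib, Finset.sum_sub_distrib, ← Finset.mul_sum, ← Finset.mul_sum,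
      Finset.sum_const, Finset.card_univ, nsmul_eq_mul, ← hA, ← hB]
    field_simp
    ring
  rw [e] at h
  have h2 : A * B / N ≤ ∑ ω, a ω * b ω := sub_nonneg.1 h
  have h3 := mul_le_mul_of_nonneg_left h2 hNpos.le
  have e2 : N * (A * B / N) = A * B := by field_simp
  rw [e2] at h3
  exact h3

/-- Antitone `a, b` on `Set ι` with `0 ≤ Σ a` and `0 ≤ Σ b` satisfy `0 ≤ Σ a b` (Harris for the reversed order: compose
with the complement involution, then `harris_uniform_cov`). [folklore] -/
theorem sum_mul_nonneg_of_antitone {a b : Set ι → ℝ} (ha : Antitone a) (hb : Antitone b) (ha0 : 0 ≤ ∑ ω, a ω)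
    (hb0 : 0 ≤ ∑ ω, b ω) : 0 ≤ ∑ ω, a ω * b ω := by
  have ha' : Monotone fun ω : Set ι => a ωᶜ := fun x y hxy => ha (Set.compl_subset_compl.2 hxy)
  have hb' : Monotone fun ω : Set ι => b ωᶜ := fun x y hxy => hb (Set.compl_subset_compl.2 hxy)
  have h := harris_uniform_cov ha' hb'
  have r1 : ∑ ω : Set ι, a ωᶜ = ∑ ω, a ω :=
    Fintype.sum_equiv (Function.Involutive.toPerm (compl : Set ι → Set ι) compl_involutive) _ _ (fun _ => rfl)
  have r2 : ∑ ω : Set ι, b ωᶜ = ∑ ω, b ω :=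
    Fintype.sum_equiv (Function.Involutive.toPerm (compl : Set ι → Set ι) compl_involutive) _ _ (fun _ => rfl)
  have r3 : ∑ ω : Set ι, a ωᶜ * b ωᶜ = ∑ ω, a ω * b ω :=
    Fintype.sum_equiv (Function.Involutive.toPerm (compl : Set ι → Set ι) compl_involutive) _ _ (fun _ => rfl)
  rw [r1, r2, r3] at h
  have hNpos : (0 : ℝ) < (Fintype.card (Set ι) : ℝ) := by exact_mod_cast Fintype.card_pos
  have h4 : 0 ≤ (Fintype.card (Set ι) : ℝ) * ∑ ω, a ω * b ω := (mul_nonneg ha0 hb0).trans h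
  exact (mul_nonneg_iff_of_pos_left hNpos).1 h4

end Lattice

section Abstract

variable {β : Type*} [Fintype β] {α : Type*} [Preorder α]

/-- **Frozen piece lemma, order-theoretic core** (gen 46).  If `Ψ, Φ : Set β → α` are antitone with `Ψ S ≤ Φ S` for all
`S`, and `F, G : α → ℝ` are monotone, then `0 ≤ Σ_{S : Set β} (F (Φ S) − F (Ψ Sᶜ)) · (G (Φ S) − G (Ψ Sᶜ))`.
Reading: `Φ S` = (augmented) red cluster of the member `S` of a flip cube whose frozen block is up, `Ψ S` = red cluster
of the same member with the frozen block down, so that `Ψ Sᶜ` is the blue cluster of the member `S`.  `Ψ = Φ` is the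
piece lemma `piece_abstract`.
Proof: both factors are antitone in `S`; `Σ_S (F(Φ S) − F(Ψ Sᶜ)) = Σ_S (F(Φ S) − F(Ψ S)) ≥ 0`; `sum_mul_nonneg_of_antitone`.
[folklore] -/
theorem frozen_piece_abstract (Ψ Φ : Set β → α) (hΨ : Antitone Ψ) (hΦ : Antitone Φ) (hle : ∀ S, Ψ S ≤ Φ S)
    {F G : α → ℝ} (hF : Monotone F) (hG : Monotone G) :
    0 ≤ ∑ S : Set β, (F (Φ S) - F (Ψ Sᶜ)) * (G (Φ S) - G (Ψ Sᶜ)) := by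
  have anti : ∀ H : α → ℝ, Monotone H → Antitone fun S : Set β => H (Φ S) - H (Ψ Sᶜ) := fun H hH S S' h =>
    sub_le_sub (hH (hΦ h)) (hH (hΨ (Set.compl_subset_compl.2 h)))
  have sums : ∀ H : α → ℝ, Monotone H → 0 ≤ ∑ S : Set β, (H (Φ S) - H (Ψ Sᶜ)) := by
    intro H hH
    have r : ∑ S : Set β, H (Ψ Sᶜ) = ∑ S : Set β, H (Ψ S) :=
      Fintype.sum_equiv (Function.Involutive.toPerm (compl : Set β → Set β) compl_involutive) _ _ (fun _ => rfl)
    rw [Finset.sum_sub_distrib, r, ← Finset.sum_sub_distrib]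
    exact Finset.sum_nonneg fun S _ => sub_nonneg.2 (hH (hle S))
  exact sum_mul_nonneg_of_antitone (anti F hF) (anti G hG) (sums F hF) (sums G hG)

/-- The frozen piece lemma with the roles displayed the other way round (frozen block DOWN): for antitone `Ψ ≤ Φ` and
monotone `F, G`, `0 ≤ Σ_S (F (Ψ S) − F (Φ Sᶜ)) · (G (Ψ S) − G (Φ Sᶜ))` — here `Ψ S` is the red cluster of the member `S`
(frozen block down) and `Φ Sᶜ ⊇` its blue cluster, possibly augmented.  (Reindex `S ↦ Sᶜ` in `frozen_piece_abstract`.)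
[folklore] -/
theorem frozen_piece_abstract_down (Ψ Φ : Set β → α) (hΨ : Antitone Ψ) (hΦ : Antitone Φ) (hle : ∀ S, Ψ S ≤ Φ S)
    {F G : α → ℝ} (hF : Monotone F) (hG : Monotone G) :
    0 ≤ ∑ S : Set β, (F (Ψ S) - F (Φ Sᶜ)) * (G (Ψ S) - G (Φ Sᶜ)) := by
  have h := frozen_piece_abstract Ψ Φ hΨ hΦ hle hF hG
  have r : ∑ S : Set β, (F (Φ S) - F (Ψ Sᶜ)) * (G (Φ S) - G (Ψ Sᶜ)) =
      ∑ S : Set β, (F (Ψ S) - F (Φ Sᶜ)) * (G (Ψ S) - G (Φ Sᶜ)) := by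
    refine Fintype.sum_equiv (Function.Involutive.toPerm (compl : Set β → Set β) compl_involutive) _ _ (fun S => ?_)
    show (F (Φ S) - F (Ψ Sᶜ)) * (G (Φ S) - G (Ψ Sᶜ)) = (F (Ψ Sᶜ) - F (Φ Sᶜᶜ)) * (G (Ψ Sᶜ) - G (Φ Sᶜᶜ))
    rw [compl_compl]; ring
  rw [r] at h
  exact h

end Abstract

section Clusters

variable {V : Type*}

/-- **Frozen piece lemma, cluster form, frozen block UP with a red-side augmentation.**  Let `T : Set β → Set (Sym2 V)` be
the members of a flip cube and `Z` a further ("frozen") edge set such that: the red cluster of the `Z`-flipped member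
`T S ∆ Z` is antitone in `S` and contained in the red cluster of `T S` (flipping `Z` down never helps red); the blue cluster
of `T S` is the red cluster of `T Sᶜ ∆ Z` (complement symmetry, `frozen_blue_eq_red_compl`); and `A S ⊇ red(T S)` is any
antitone "augmented red side".  Then for increasing `F, G`: `0 ≤ Σ_S (F(A S) − F(blue S))(G(A S) − G(blue S))`.
[folklore] -/
theorem frozen_piece_sum_nonneg {β : Type*} [Fintype β] (E : Set (Sym2 V)) (s : V) (T : Set β → Set (Sym2 V))
    (Z : Set (Sym2 V)) (A : Set β → Set (Sym2 V)) (hA : Antitone A)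
    (hAred : ∀ S, openEdgeCluster (T S ∩ E) s ⊆ A S)
    (hantiZ : Antitone fun S => openEdgeCluster ((T S ∆ Z) ∩ E) s)
    (hZ : ∀ S, openEdgeCluster ((T S ∆ Z) ∩ E) s ⊆ openEdgeCluster (T S ∩ E) s)
    (hblue : ∀ S, openEdgeCluster ((T S)ᶜ ∩ E) s = openEdgeCluster ((T Sᶜ ∆ Z) ∩ E) s)
    {F G : Set (Sym2 V) → ℝ} (hF : Monotone F) (hG : Monotone G) :
    0 ≤ ∑ S : Set β, (F (A S) - F (openEdgeCluster ((T S)ᶜ ∩ E) s)) *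
      (G (A S) - G (openEdgeCluster ((T S)ᶜ ∩ E) s)) := by
  have h := frozen_piece_abstract (fun S => openEdgeCluster ((T S ∆ Z) ∩ E) s) A hantiZ hA
    (fun S => (hZ S).trans (hAred S)) hF hG
  refine h.trans_eq (Finset.sum_congr rfl fun S _ => ?_)
  simp only [hblue S]

/-- **Frozen piece lemma, cluster form, frozen block DOWN with a blue-side augmentation.**  Members `T S` (frozen block
down); hypotheses: the red cluster of `T S` is antitone in `S` and contained in that of the `Z`-flipped colouring
`T S ∆ Z` (frozen block up); blue(`T S`) = red(`T Sᶜ ∆ Z`); `B S ⊇ blue(T S)` is any isotone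
"augmented blue side".  Then `0 ≤ Σ_S (F(red S) − F(B S))(G(red S) − G(B S))` for increasing `F, G`. [folklore] -/
theorem frozen_piece_sum_nonneg_down {β : Type*} [Fintype β] (E : Set (Sym2 V)) (s : V) (T : Set β → Set (Sym2 V))
    (Z : Set (Sym2 V)) (B : Set β → Set (Sym2 V)) (hB : Monotone B)
    (hBblue : ∀ S, openEdgeCluster ((T S)ᶜ ∩ E) s ⊆ B S)
    (hanti : Antitone fun S => openEdgeCluster (T S ∩ E) s)
    (hZ : ∀ S, openEdgeCluster (T S ∩ E) s ⊆ openEdgeCluster ((T S ∆ Z) ∩ E) s)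
    (hblue : ∀ S, openEdgeCluster ((T S)ᶜ ∩ E) s = openEdgeCluster ((T Sᶜ ∆ Z) ∩ E) s)
    {F G : Set (Sym2 V) → ℝ} (hF : Monotone F) (hG : Monotone G) :
    0 ≤ ∑ S : Set β, (F (openEdgeCluster (T S ∩ E) s) - F (B S)) *
      (G (openEdgeCluster (T S ∩ E) s) - G (B S)) := by
  -- Φ S := B Sᶜ is antitone and dominates red((T S) ∆ Z) = blue(T Sᶜ) ⊆ B Sᶜ.
  have hΦ : Antitone fun S : Set β => B Sᶜ := fun S S' h => hB (Set.compl_subset_compl.2 h)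
  have hle : ∀ S, openEdgeCluster (T S ∩ E) s ≤ B Sᶜ := by
    intro S
    refine (hZ S).trans ?_
    have e1 : openEdgeCluster ((T S ∆ Z) ∩ E) s = openEdgeCluster ((T Sᶜ)ᶜ ∩ E) s := by
      rw [hblue Sᶜ, compl_compl]
    rw [e1]
    exact hBblue Sᶜ
  have h := frozen_piece_abstract_down (fun S => openEdgeCluster (T S ∩ E) s) (fun S => B Sᶜ) hanti hΦ hle hF hG
  refine h.trans_eq (Finset.sum_congr rfl fun S _ => ?_)
  simp only [compl_compl]

/-- On `E`, if `U`, `U'`, `Z` cover `E` and are pairwise disjoint on `E`, then the complement of `ω ∆ U` agrees with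
`(ω ∆ U') ∆ Z`: `(ω ∆ U)ᶜ ∩ E = ((ω ∆ U') ∆ Z) ∩ E`. [folklore] -/
theorem compl_symmDiff_inter_frozen (ω U U' Z E : Set (Sym2 V)) (hcov : E ⊆ U ∪ U' ∪ Z)
    (hUU' : ∀ e ∈ E, e ∈ U → e ∉ U') (hUZ : ∀ e ∈ E, e ∈ U → e ∉ Z) (hU'Z : ∀ e ∈ E, e ∈ U' → e ∉ Z) :
    (ω ∆ U)ᶜ ∩ E = ((ω ∆ U') ∆ Z) ∩ E := by
  rw [compl_symmDiff_inter ω U (U' ∪ Z) E (by simpa only [Set.union_assoc] using hcov)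
    (fun e he hU h => h.elim (hUU' e he hU) (hUZ e he hU))]
  ext e
  simp only [Set.mem_inter_iff, Set.mem_symmDiff, Set.mem_union]
  constructor
  · rintro ⟨h1, hE⟩
    refine ⟨?_, hE⟩
    have := hU'Z e hE
    tauto
  · rintro ⟨h1, hE⟩
    refine ⟨?_, hE⟩
    have := hU'Z e hE
    tauto

/-- **Complement symmetry for frozen flip cubes.**  If the blocks `g i` (`i ∈ β`) and the frozen set `Z` cover `E` and are
pairwise disjoint on `E`, then for `T S = ω ∆ ⋃_{i ∈ S} g i` the blue cluster of `T S` is the red cluster of `T Sᶜ ∆ Z`.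
[folklore] -/
theorem frozen_blue_eq_red_compl {β : Type*} (E : Set (Sym2 V)) (s : V) (ω : Set (Sym2 V)) (g : β → Set (Sym2 V))
    (Z : Set (Sym2 V)) (hcov : E ⊆ (⋃ i, g i) ∪ Z) (hdisj : ∀ i j, i ≠ j → ∀ e ∈ E, e ∈ g i → e ∉ g j)
    (hZ : ∀ i, ∀ e ∈ E, e ∈ g i → e ∉ Z) (S : Set β) :
    openEdgeCluster ((ω ∆ ⋃ i ∈ S, g i)ᶜ ∩ E) s = openEdgeCluster (((ω ∆ ⋃ i ∈ Sᶜ, g i) ∆ Z) ∩ E) s := by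
  rw [compl_symmDiff_inter_frozen ω (⋃ i ∈ S, g i) (⋃ i ∈ Sᶜ, g i) Z E]
  · intro e he
    rcases hcov he with h | h
    · obtain ⟨i, hi⟩ := Set.mem_iUnion.1 h
      by_cases hS : i ∈ S
      · exact Or.inl (Or.inl (Set.mem_biUnion hS hi))
      · exact Or.inl (Or.inr (Set.mem_biUnion (Set.mem_compl hS) hi))
    · exact Or.inr h
  · intro e he h1 h2
    obtain ⟨i, hi, hei⟩ := Set.mem_iUnion₂.1 h1
    obtain ⟨j, hj, hej⟩ := Set.mem_iUnion₂.1 h2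
    have hij : i ≠ j := fun h => hj (h ▸ hi)
    exact hdisj i j hij e he hei hej
  · intro e he h1 h2
    obtain ⟨i, _, hei⟩ := Set.mem_iUnion₂.1 h1
    exact hZ i e he hei h2
  · intro e he h1 h2
    obtain ⟨i, _, hei⟩ := Set.mem_iUnion₂.1 h1
    exact hZ i e he hei h2

end Clusters

end Antithetic

end Summit.CriticalPhenomena.PercolationContinuityZ3.Theorems
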